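import Literature.MathematicalPhysics.QuantumFieldTheory.Balaban1983to89.B12Decay510
import Literature.MathematicalPhysics.QuantumFieldTheory.Balaban1983to89.B12PolarizationTensor120
import Literature.MathematicalPhysics.QuantumFieldTheory.Balaban1983to89.Node00.BetaOfRecord
import Literature.MathematicalPhysics.QuantumFieldTheory.Balaban1983to89.FlowStep
import Literature.MathematicalPhysics.QuantumFieldTheory.Balaban1983to89.Node00.Sect2FrameOfRecord

/-! # CRIT-1 g32 — `Crit1DictV3JunkBundle.lean`: byte copy of lens-1 g2 `nodeO-cover/LENS-1-PortDictionary-TheoremsDraft-v3.lean`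
(sha16 0dd484ce1e459aed, 716 l.; namespace renamed `…Theorems.N3PortDictionaryDraft` → `…Cruxes.Record13SepCoPHInhabited.Crit1DictV3Copy`,
nothing else touched) + ONE appended section `Crit1JunkBundle` (at the end) with the kernel-checked ONE-PIECE JUNK INHABITANT of §12's
`ThmThreeFormatBundle`.  Verdict and the accepted mould (M) for 27930 (S1): HOME STATUS line of this commit and sheet
`CRIT-1-S1-mould-g32.md`.  Nothing of Bałaban asserted; stub 2′ UNPORTED; K0⁷ open; the Yang–Mills mass gap is NOT proved. -/


/-!
# N3 PORT DICTIONARY v3 (draft for `Theorems/BalabanUVNodesN3PortDictionary.lean`, CRIT-1 g32 recommendation (b) of sheet `CRIT-1-PTsig-lens1-v01-g32.md` 3e0a4bdc69f0f040)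

Source: lens-1 g2 HOME `nodeO-cover/LENS-1-PortSignatures-v0.3.lean` 57622cad381b6207, §1 (window-level shapes only: `RowE118`, `N3PairShapeAt`, `N3PairShape`), §2–§5, §7, §10 —
i.e. the ABSTRACT ports PT-C ∕ PT-B ∕ PT-A (all PROVED), the placeholders and their record-level (rec) readings, the shared `PairData` carrier with the seven predicate groups and
`Ported ⟺ N3PairShapeAt`, the placeholder ⟹ groups composition, and the DATA ∕ OBLIGATION split (`FmtData ∕ ChartData ∕ ResponseData`, `FmtObligations ∕ ChartObligations ∕
ResponseObligations`, `n3PairShapeAt_of_obligations`) + §11 (v2, director-ym №426): the RULE (v) guards for the (S1) ∕ T1 typing — pieces INDEXED BY THE RECORD's 𝐃_{k+1} (`FmtDataOver S`,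
`recordDomSys F Mc k K := Node00.Sect2.domSys (F.P K) Mc (k+1)`), LOCAL in their domain's coordinates (`FmtLocality`), and (S1) over the fixed index (`ReprS1Over`) + §12 (v3, CRIT-1 l.3447 (J1)–(J4)): the SINGLE-ITEM ∃-bundle `ThmThreeFormatBundle` over SHARED data (one `D` for T1's bounds,
(S1)'s equation and the chart image; `Φf` a parameter = the record's functional by tree name (J2); `E₀ κ` outside every binder (J3); the chart maps into THE SAME `D.Uc` (J4)).  OMITTED on purpose: the record-level decls `kerZB ∕ N3PairLocalityAt ∕ N3PairCofinal ∕ PortedFormatCofinal` (§1∕§6 — they belong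
to `Lines∕cauchy-analytic`, PT-E, operator write; that file can `import` this module and alias `N3PairShapeAt`), the struck `--signature` texts (§8), and the rule-(N) toy (§9; HOME only).

STATUS OF USE (CRIT-1 split verdict l.3411, accepted by lens-1): these are DICTIONARY LEMMAS, count-neutral, NOT the items 27930–27932 (whose texts are re-purposed to the record-level
PRIMITIVES = `FmtObligations ∕ ChartObligations ∕ ResponseObligations` + (S1) instantiated at DEF-1's record data, informal until T1∕DEF-1 land).  Filing (any prover keyed 20541, NOT lens-1):
`ledger propose --kind proof --target Summits/QuantumFields/YangMills/Theorems/BalabanUVNodesN3PortDictionary.lean --file <this> --supports stmt-QuantumFields-20541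
--note "N3 port dictionary (lens-1 v0.3 §1∕2–5∕7∕10; CRIT-1 (b))"`.  Imports: five `Literature` modules only.  0 sorry.

HONEST: calculus ∕ re-lettering lemmas and carriers; nothing of Bałaban's estimates is asserted, ported or discharged here; stub 2′ OPEN; K0⁷ NOT closed; the YM mass gap is NOT proved.
-/

noncomputable section

open Filter Topology Metric
open scoped BigOperators

namespace Summit.QuantumFields.YangMills.Cruxes.Record13SepCoPHInhabited.Crit1DictV3Copy

open Literature.MathematicalPhysics.QuantumFieldTheory.Balaban1983to89
open Literature.MathematicalPhysics.QuantumFieldTheory.Balaban1983to89.Node00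
open Literature.MathematicalPhysics.QuantumFieldTheory.Balaban1983to89.T4Continuum (T4Family)
open Literature.MathematicalPhysics.QuantumFieldTheory.Balaban1983to89.FlowStep (Box)
open Literature.MathematicalPhysics.QuantumFieldTheory.Balaban1983to89.B12Sec2to5 (l1)
open Literature.MathematicalPhysics.QuantumFieldTheory.Balaban1983to89.B12Decay510
open Literature.MathematicalPhysics.QuantumFieldTheory.Balaban1983to89.B12PolarizationTensor120 (polComp polTensor expChart)

/-! ## §1  WINDOW-LEVEL SHAPES of `Lines∕cauchy-analytic` (f8d80c51dbb93008 :308 ∕ :324 ∕ :348), record-free -/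

/-- COPY of `Lines∕cauchy-analytic` :308 — WALL ROW E, the (1.18) share, NAMED. [cite: Balaban1987RG1, (1.18) p.263] -/
def RowE118 (S : LocDomainSys) {m : ℕ} (EX : S.Dom → (Fin m → ℂ) → ℂ) (α₂ E₀ κ : ℝ) : Prop :=
  (∀ X, AnalyticOnNhd ℂ (EX X) (ball 0 α₂)) ∧ (∀ X, ∀ w ∈ ball (0 : Fin m → ℂ) α₂, ‖EX X w‖ ≤ E₀ * Real.exp (-κ * S.dj X))

open Classical in
/-- COPY of `Lines∕cauchy-analytic` :324 — the abstract shape of N3-PAIR LOCALITY at one window point (R1 window guards, R2 hoisting). [cite: Balaban1987RG1, (1.7) p.261, (1.18) p.263, (1.21) p.264, (4.35) p.290] -/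
def N3PairShapeAt (N : ℕ → ℕ → ℕ) (Pk : (k : ℕ) → (Fin (k + 1) → ℝ) → ℕ → Fin 4 → Fin 4 → (Fin 4 → ℤ) → ℝ)
    (α₂ E₀ Bh κ δ₀ M c₁ K₀ K₁ K₀' K₁' : ℝ) (k : ℕ) (v : Fin (k + 1) → ℝ) : Prop :=
    ∃ (S : ℕ → LocDomainSys) (Cc : (K : ℕ) → B12.CubeCover (S K)) (Λ : ℕ → Type) (G : (K : ℕ) → SiteGeometry (Cc K) (Λ K))
      (ρ : (K : ℕ) → Λ K → Λ K → ℝ) (m : ℕ → ℕ) (EX : (K : ℕ) → (S K).Dom → (Fin (m K) → ℂ) → ℂ) (h : (K : ℕ) → (S K).Dom → Λ K → (Fin (m K) → ℂ))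
      (e : (K : ℕ) → Fin 4 → (Fin 4 → ℤ) → Λ K) (wrap : (K : ℕ) → Finset (S K).Dom) (emb : (K : ℕ) → (S K).Dom → (S (K + 1)).Dom)
      (T : (K : ℕ) → (S K).Dom → ((Fin (m (K + 1)) → ℂ) →L[ℂ] (Fin (m K) → ℂ))),
      ∀ K : ℕ,
        RowE118 (S K) (EX K) α₂ E₀ κ ∧
        (∀ X x, ‖h K X x‖ ≤ Bh * Real.exp (-δ₀ * (G K).distD x X)) ∧
        GeomLeaf (G K) (ρ K) M c₁ ∧ CubeSumLeaf (G K) (δ₀ / 2) K₁ ∧ TreeLeaf (Cc K) (κ / 2) K₀ ∧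
        CubeSumLeaf (G K) (δ₀ / 2 / 2) K₁' ∧ TreeLeaf (Cc K) (κ / 2 / 2) K₀' ∧
        Set.InjOn (emb K) ((wrap K)ᶜ : Finset (S K).Dom) ∧
        (∀ X ∈ wrap K, (N k K : ℝ) / M ≤ (S K).dj X) ∧
        (∀ Y : (S (K + 1)).Dom, (∀ X, X ∉ wrap K → emb K X ≠ Y) → (N k K : ℝ) / M ≤ (S (K + 1)).dj Y) ∧
        (∀ X, X ∉ wrap K → ∀ w, EX (K + 1) (emb K X) w = EX K X (T K X w)) ∧
        (∀ X (μ : Fin 4) (z : Fin 4 → ℤ), X ∉ wrap K → (∀ i, 2 * |z i| < (N k K : ℤ)) →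
          ‖T K X (h (K + 1) (emb K X) (e (K + 1) μ z)) - h K X (e K μ z)‖
            ≤ Bh * Real.exp (-δ₀ * (N k K : ℝ) / 2) * Real.exp (-(δ₀ / 2) * (G K).distD (e K μ z) X)) ∧
        ∀ (μ ν : Fin 4) (z : Fin 4 → ℤ), (∀ i, 2 * |z i| < (N k K : ℤ)) →
          ρ K (e K μ 0) (e K ν z) = l1 z ∧
          Pk k v K μ ν z = ∑ X, (mixedDeriv (EX K X) (h K X (e K μ 0)) (h K X (e K ν z))).re

/-- COPY of `Lines∕cauchy-analytic` :348 — the shape at every window point with the same constants. [cite: Balaban1987RG1, Thm 3 p.264, (1.18) p.263] -/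
def N3PairShape (N : ℕ → ℕ → ℕ) (Pk : (k : ℕ) → (Fin (k + 1) → ℝ) → ℕ → Fin 4 → Fin 4 → (Fin 4 → ℤ) → ℝ)
    (γ₀ α₂ E₀ Bh κ δ₀ M c₁ K₀ K₁ K₀' K₁' : ℝ) : Prop :=
  ∀ k (v : Fin (k + 1) → ℝ), v ∈ Box γ₀ k → N3PairShapeAt N Pk α₂ E₀ Bh κ δ₀ M c₁ K₀ K₁ K₀' K₁' k v


/-! ## §2  PT-C — `stmt-QuantumFields-27932 PortRowE118U2`
Print side: the localized piece `E^{(k+1)}(X, ·)` is an ANALYTIC function on print's complex space `U^c_{k+1}(X, α₀, α₁)` ((1.11)–(1.17) p.262–263; analyticity p.261 L37) with the bound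
(1.18) `|E| ≤ E₀e^{−κd(X)}` there — THIS is the level-(k+1) format, i.e. Thm 3's conclusion; and the BACKGROUND CHART `χ_X : w ↦ (configuration on X̃ generated by the complexified field w)` is
entire and maps the `α₂`-ball INTO `U^c_{k+1}(X, α₀, α₁)` ((3.36)–(3.54) p.277–280 — the boundary with PT-F).  Lens-1 side: `RowE118 S (E ∘ χ) α₂ E₀ κ`.  The port is COMPOSITION. -/

/-- **PT-C (abs)** — candidate signature for `PortRowE118U2`: analytic pieces with the (1.18) bound on abstract complex spaces `Uc X`, composed with entire charts mapping the `α₂`-ball into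
`Uc X`, inhabit lens-1's `RowE118` slots.  CONDITIONAL on its four print-side hypotheses (never «the record's pieces satisfy (1.18)» outright). [cite: Balaban1987RG1, (1.18) p.263, (3.36)–(3.54) pp.277–280] -/
def PortRowE118U2 : Prop :=
  ∀ (S : LocDomainSys) (M m : ℕ) (E : S.Dom → (Fin M → ℂ) → ℂ) (Uc : S.Dom → Set (Fin M → ℂ))
    (χ : S.Dom → (Fin m → ℂ) → (Fin M → ℂ)) (α₂ E₀ κ : ℝ),
    (∀ X, AnalyticOnNhd ℂ (E X) (Uc X)) →
    (∀ X, ∀ u ∈ Uc X, ‖E X u‖ ≤ E₀ * Real.exp (-κ * S.dj X)) →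
    (∀ X, AnalyticOnNhd ℂ (χ X) Set.univ) →
    (∀ X, Set.MapsTo (χ X) (ball 0 α₂) (Uc X)) →
    RowE118 S (fun X => E X ∘ χ X) α₂ E₀ κ

/-- PT-C (abs) HOLDS — composition of analytic maps (`AnalyticOnNhd.comp`) and transport of the bound along `MapsTo`.  Size XS: the census's «M» for PT-C lives in the HYPOTHESES at the
record (Thm 3's (1.18) and the chart containment (3.36)–(3.54)), not in the implication. [cite: Balaban1987RG1, (1.18) p.263, (3.36)–(3.54) pp.277–280] -/
theorem portRowE118U2_holds : PortRowE118U2 := by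
  intro S M m E Uc χ α₂ E₀ κ hE hb hχ hmaps
  refine ⟨fun X => ?_, fun X w hw => ?_⟩
  · exact (hE X).comp ((hχ X).mono (Set.subset_univ _)) (hmaps X)
  · exact hb X _ (hmaps X hw)

/-- **PLACEHOLDER for typer-1's T1 pin `Fmt⁺` AT ONE WINDOW POINT `(k, v)`** (NOT the pin; DATA + the two print-side properties PT-C consumes, per volume `K`): the localization-domain
systems of the record's `(k+1)`-st step on the `K`-th torus, the number `M K` of complex configuration coordinates, the pieces `E K X` as functions of complexified configurations, print's
complex spaces `U^c_{k+1}(X, α₀, α₁)` in coordinates, ANALYTICITY and (1.18) there with constants `E₀, κ` fixed ABOVE the window point. [cite: Balaban1987RG1, p.261 L37, (1.11)–(1.18) pp.262–263] -/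
structure FmtPlusPinPLACEHOLDER (E₀ κ : ℝ) where
  /-- `𝐃_{k+1}` on the `K`-th torus with `d_{k+1}` -/
  S : ℕ → LocDomainSys
  /-- number of complex configuration coordinates on the `K`-th torus -/
  M : ℕ → ℕ
  /-- the localized pieces `E^{(k+1)}(X, ·)` in coordinates -/
  E : (K : ℕ) → (S K).Dom → (Fin (M K) → ℂ) → ℂ
  /-- print's `U^c_{k+1}(X, α₀, α₁)` in coordinates -/
  Uc : (K : ℕ) → (S K).Dom → Set (Fin (M K) → ℂ)
  /-- p.261 L37: «analytic on a space of …» -/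
  analytic : ∀ K X, AnalyticOnNhd ℂ (E K X) (Uc K X)
  /-- (1.18) with ABSOLUTE constants -/
  bound118 : ∀ K X, ∀ u ∈ Uc K X, ‖E K X u‖ ≤ E₀ * Real.exp (-κ * (S K).dj X)

/-- **PLACEHOLDER for the BACKGROUND CHART at radius `α₂`** (DEF-1's object; the containment is [I] (3.36)–(3.54), PT-F's analytic part): per volume and domain an ENTIRE map from the
`m K` complexified field coordinates to configuration coordinates, mapping the `α₂`-ball into `U^c`. [cite: Balaban1987RG1, (3.36)–(3.54) pp.277–280] -/
structure BackgroundChartPLACEHOLDER {E₀ κ : ℝ} (Φ : FmtPlusPinPLACEHOLDER E₀ κ) (α₂ : ℝ) where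
  /-- number of complexified field coordinates on the `K`-th torus (lens-1's `m K`) -/
  m : ℕ → ℕ
  /-- the chart -/
  χ : (K : ℕ) → (Φ.S K).Dom → (Fin (m K) → ℂ) → (Fin (Φ.M K) → ℂ)
  entire : ∀ K X, AnalyticOnNhd ℂ (χ K X) Set.univ
  mapsTo : ∀ K X, Set.MapsTo (χ K X) (ball 0 α₂) (Φ.Uc K X)

/-- **PT-C (rec)** — the record-level reading of `PortRowE118U2` over the placeholders: lens-1's `RowE118` slots for the charted pieces `E K X ∘ χ K X`, every volume.
[cite: Balaban1987RG1, (1.18) p.263, (3.36)–(3.54) pp.277–280] -/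
def PortRowE118U2Rec {E₀ κ α₂ : ℝ} (Φ : FmtPlusPinPLACEHOLDER E₀ κ) (C : BackgroundChartPLACEHOLDER Φ α₂) : Prop :=
  ∀ K, RowE118 (Φ.S K) (fun X => Φ.E K X ∘ C.χ K X) α₂ E₀ κ

/-- PT-C (rec) HOLDS over the placeholders, by PT-C (abs). [cite: Balaban1987RG1, (1.18) p.263] -/
theorem portRowE118U2Rec_holds {E₀ κ α₂ : ℝ} (Φ : FmtPlusPinPLACEHOLDER E₀ κ) (C : BackgroundChartPLACEHOLDER Φ α₂) : PortRowE118U2Rec Φ C :=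
  fun K => portRowE118U2_holds (Φ.S K) (Φ.M K) (C.m K) (Φ.E K) (Φ.Uc K) (C.χ K) α₂ E₀ κ (Φ.analytic K) (Φ.bound118 K) (C.entire K) (C.mapsTo K)

/-! ## §3  PT-B — `stmt-QuantumFields-27931 PortPieceLocalityU8` = B1 (piece identity off the wrap class) + B2a (plain response decay :332) + B2b (restricted response-tail difference :339–:341)
Print side: (1.7) p.261 L21 «the term corresponding to a domain X depends on U_j restricted to X» + p.264 L19–20 (the pieces of a non-wrapping domain do not see the torus size) give, AT THE
CONFIGURATION LEVEL, `E^{(K+1)}_{emb X} = E^{(K)}_X ∘ π_X` with `π_X` the restriction of configuration coordinates; the background chart INTERTWINES `π_X ∘ χ^{(K+1)}_{emb X} = χ^{(K)}_X ∘ T_X`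
(DEF-1, definitional for the exponential chart of a local field); [15] = CMP 102 Prop. 9 gives the DECAY of the linearized-minimizer response kernel and (with the method of images on the torus)
its TWO-VOLUME COMPARISON on the fundamental window; lens-1's responses are the kernel's coordinates CUT to the domain's coordinate set (model choice M1: cut coordinates, sup norm —
typer-1∕DEF-1 may replace it; the port lemmas are where the choice is consumed). -/

/-- **PT-B1 (abs)** — candidate signature, first clause of `PortPieceLocalityU8`: configuration-level volume independence of the pieces off the wrap class + chart intertwining ⟹ lens-1's
piece identity :338 for the charted pieces. [cite: Balaban1987RG1, (1.7) p.261, (1.21) p.264] -/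
def PortPieceIdentityU8 : Prop :=
  ∀ (D D' : Type) (M M' m m' : ℕ) (E : D → (Fin M → ℂ) → ℂ) (E' : D' → (Fin M' → ℂ) → ℂ)
    (χ : D → (Fin m → ℂ) → (Fin M → ℂ)) (χ' : D' → (Fin m' → ℂ) → (Fin M' → ℂ))
    (wrap : Finset D) (emb : D → D') (π : D → (Fin M' → ℂ) → (Fin M → ℂ)) (T : D → ((Fin m' → ℂ) →L[ℂ] (Fin m → ℂ))),
    (∀ X, X ∉ wrap → ∀ u', E' (emb X) u' = E X (π X u')) →
    (∀ X, X ∉ wrap → ∀ w', π X (χ' (emb X) w') = χ X (T X w')) →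
    ∀ X, X ∉ wrap → ∀ w', (E' (emb X) ∘ χ' (emb X)) w' = (E X ∘ χ X) (T X w')

/-- PT-B1 (abs) HOLDS — two rewrites.  Size XS: the content at the record is the DEFINITION of `emb`, `π`, `T` (DEF-1) and the configuration-level identity (print's (1.7) + construction).
[cite: Balaban1987RG1, (1.7) p.261] -/
theorem portPieceIdentityU8_holds : PortPieceIdentityU8 := by
  intro D D' M M' m m' E E' χ χ' wrap emb π T hE hχ X hX w'
  show E' (emb X) (χ' (emb X) w') = E X (χ X (T X w'))
  rw [hE X hX, hχ X hX]

/-- The response CUT to a coordinate set (model M1): the coordinates of the full linearized-minimizer response `Gk x` kept on `cX`, zero elsewhere. [cite: Balaban1987RG1, (4.35) p.290] -/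
def cutResponse {Λ : Type} {m : ℕ} (cX : Finset (Fin m)) (Gk : Λ → Fin m → ℂ) (x : Λ) : Fin m → ℂ :=
  fun i => if i ∈ cX then Gk x i else 0

/-- The coordinate RESTRICTION map of lens-1's clauses :338∕:339–:341 (model M1): pull the coordinates `j i`, `i ∈ cX`, of the larger volume back, zero elsewhere — a continuous linear map.
[cite: Balaban1987RG1, (1.7) p.261] -/
def restrictCLM {m m' : ℕ} (cX : Finset (Fin m)) (j : Fin m → Fin m') : (Fin m' → ℂ) →L[ℂ] (Fin m → ℂ) :=
  ContinuousLinearMap.pi fun i => if i ∈ cX then ContinuousLinearMap.proj (j i) else 0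

/-- `restrictCLM` coordinatewise. [folklore] -/
theorem restrictCLM_apply {m m' : ℕ} (cX : Finset (Fin m)) (j : Fin m → Fin m') (u : Fin m' → ℂ) (i : Fin m) :
    restrictCLM cX j u i = if i ∈ cX then u (j i) else 0 := by
  unfold restrictCLM
  rw [ContinuousLinearMap.pi_apply]
  split_ifs <;> simp

/-- **PT-B2a (abs)** — candidate signature, the PLAIN response decay :332 of `PortPieceLocalityU8`: [15] Prop. 9-shaped decay of the response kernel's coordinates + «the coordinates of a
domain lie within `w` of it» ⟹ `‖cut response‖ ≤ C₉e^{δ₀w}·e^{−δ₀ dist(x, X)}` (sup norm). [cite: Balaban1985Variational, Prop. 9; Balaban1987RG1, p.282 (remark after (4.5))] -/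
def PortResponseDecayU8 : Prop :=
  ∀ (S : LocDomainSys) (C : B12.CubeCover S) (Λ : Type) (G : SiteGeometry C Λ) (ρ : Λ → Λ → ℝ) (m : ℕ)
    (cX : S.Dom → Finset (Fin m)) (siteOf : Fin m → Λ) (Gk : Λ → Fin m → ℂ) (C₉ δ₀ w : ℝ),
    0 ≤ C₉ → 0 ≤ δ₀ →
    (∀ x i, ‖Gk x i‖ ≤ C₉ * Real.exp (-δ₀ * ρ (siteOf i) x)) →
    (∀ X, ∀ i ∈ cX X, ∀ x, G.distD x X ≤ ρ (siteOf i) x + w) →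
    ∀ X x, ‖cutResponse (cX X) Gk x‖ ≤ C₉ * Real.exp (δ₀ * w) * Real.exp (-δ₀ * G.distD x X)

/-- PT-B2a (abs) HOLDS — sup norm, coordinate by coordinate. Size S. [cite: Balaban1985Variational, Prop. 9] -/
theorem portResponseDecayU8_holds : PortResponseDecayU8 := by
  intro S C Λ G ρ m cX siteOf Gk C₉ δ₀ w hC₉ hδ₀ hG hw X x
  have hR : 0 ≤ C₉ * Real.exp (δ₀ * w) * Real.exp (-δ₀ * G.distD x X) :=
    mul_nonneg (mul_nonneg hC₉ (Real.exp_pos _).le) (Real.exp_pos _).le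
  refine (pi_norm_le_iff_of_nonneg hR).mpr fun i => ?_
  simp only [cutResponse]
  split_ifs with hi
  · calc ‖Gk x i‖ ≤ C₉ * Real.exp (-δ₀ * ρ (siteOf i) x) := hG x i
      _ ≤ C₉ * Real.exp (δ₀ * w + -δ₀ * G.distD x X) := by
          refine mul_le_mul_of_nonneg_left (Real.exp_le_exp.mpr ?_) hC₉
          have h1 : δ₀ * G.distD x X ≤ δ₀ * (ρ (siteOf i) x + w) := mul_le_mul_of_nonneg_left (hw X i hi x) hδ₀
          rw [mul_add] at h1
          linarith
      _ = C₉ * Real.exp (δ₀ * w) * Real.exp (-δ₀ * G.distD x X) := by rw [Real.exp_add]; ring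
  · simpa using hR

/-- **PT-B2b (abs)** — candidate signature, the RESTRICTED response-tail DIFFERENCE :339–:341 of `PortPieceLocalityU8`: the TWO-VOLUME comparison of the response kernels on the fundamental
window ([15] Prop. 9 + images on the torus: `|G^{(K+1)}(j i, e′ μ z) − G^{(K)}(i, e μ z)| ≤ C₉e^{−δ₀N∕2}e^{−(δ₀∕2)ρ(site i, e μ z)}` for the coordinates `i` of a non-wrapping domain) + coordinate
compatibility of the unwrap embedding ⟹ lens-1's clause for the cut responses and the coordinate restriction `T_X = restrictCLM` (PROVED below, size S; the discharge of the
two-volume primitive at the record is [15] Prop. 9 + periodization = M). [cite: Balaban1985Variational, Prop. 9; Balaban1987RG1, (1.21) p.264] -/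
def PortResponseTailsU8 : Prop :=
  ∀ (S S' : LocDomainSys) (C : B12.CubeCover S) (Λ Λ' : Type) (G : SiteGeometry C Λ) (ρ : Λ → Λ → ℝ) (m m' : ℕ)
    (cX : S.Dom → Finset (Fin m)) (cX' : S'.Dom → Finset (Fin m')) (siteOf : Fin m → Λ)
    (Gk : Λ → Fin m → ℂ) (Gk' : Λ' → Fin m' → ℂ) (wrap : Finset S.Dom) (emb : S.Dom → S'.Dom) (jX : S.Dom → Fin m → Fin m')
    (e : Fin 4 → (Fin 4 → ℤ) → Λ) (e' : Fin 4 → (Fin 4 → ℤ) → Λ') (Nw : ℕ) (C₉ δ₀ w : ℝ),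
    0 ≤ C₉ → 0 ≤ δ₀ → 0 ≤ w →
    (∀ X, X ∉ wrap → ∀ i ∈ cX X, jX X i ∈ cX' (emb X)) →
    (∀ X, X ∉ wrap → ∀ i ∈ cX X, ∀ (μ : Fin 4) (z : Fin 4 → ℤ), (∀ k, 2 * |z k| < (Nw : ℤ)) →
        ‖Gk' (e' μ z) (jX X i) - Gk (e μ z) i‖ ≤ C₉ * Real.exp (-δ₀ * (Nw : ℝ) / 2) * Real.exp (-(δ₀ / 2) * ρ (siteOf i) (e μ z))) →
    (∀ X, ∀ i ∈ cX X, ∀ x, G.distD x X ≤ ρ (siteOf i) x + w) →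
    ∀ X (μ : Fin 4) (z : Fin 4 → ℤ), X ∉ wrap → (∀ k, 2 * |z k| < (Nw : ℤ)) →
      ‖restrictCLM (cX X) (jX X) (cutResponse (cX' (emb X)) Gk' (e' μ z)) - cutResponse (cX X) Gk (e μ z)‖
        ≤ C₉ * Real.exp (δ₀ * w) * Real.exp (-δ₀ * (Nw : ℝ) / 2) * Real.exp (-(δ₀ / 2) * G.distD (e μ z) X)

/-- PT-B2b (abs) HOLDS — sup norm, coordinate by coordinate; the mismatched-coordinate case is excluded by compatibility. Size S: the census's «M» for PT-B lives in the PRIMITIVES at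
the record ([15] Prop. 9 decay + the two-volume periodization comparison; the configuration-level (1.7)), not in the implication. [cite: Balaban1985Variational, Prop. 9; Balaban1987RG1, (1.21) p.264] -/
theorem portResponseTailsU8_holds : PortResponseTailsU8 := by
  intro S S' C Λ Λ' G ρ m m' cX cX' siteOf Gk Gk' wrap emb jX e e' Nw C₉ δ₀ w hC₉ hδ₀ hw0 hcompat htwo hwidth X μ z hX hz
  have hR : 0 ≤ C₉ * Real.exp (δ₀ * w) * Real.exp (-δ₀ * (Nw : ℝ) / 2) * Real.exp (-(δ₀ / 2) * G.distD (e μ z) X) :=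
    mul_nonneg (mul_nonneg (mul_nonneg hC₉ (Real.exp_pos _).le) (Real.exp_pos _).le) (Real.exp_pos _).le
  refine (pi_norm_le_iff_of_nonneg hR).mpr fun i => ?_
  simp only [Pi.sub_apply, restrictCLM_apply, cutResponse]
  by_cases hi : i ∈ cX X
  · have hj : jX X i ∈ cX' (emb X) := hcompat X hX i hi
    rw [if_pos hi, if_pos hj, if_pos hi]
    have h2 : Real.exp (δ₀ / 2 * w) ≤ Real.exp (δ₀ * w) := by
      refine Real.exp_le_exp.mpr ?_
      have h0 : 0 ≤ δ₀ * w := mul_nonneg hδ₀ hw0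
      have : δ₀ / 2 * w = δ₀ * w / 2 := by ring
      rw [this]; linarith
    calc ‖Gk' (e' μ z) (jX X i) - Gk (e μ z) i‖
        ≤ C₉ * Real.exp (-δ₀ * (Nw : ℝ) / 2) * Real.exp (-(δ₀ / 2) * ρ (siteOf i) (e μ z)) := htwo X hX i hi μ z hz
      _ ≤ C₉ * Real.exp (-δ₀ * (Nw : ℝ) / 2) * Real.exp (δ₀ / 2 * w + -(δ₀ / 2) * G.distD (e μ z) X) := by
          refine mul_le_mul_of_nonneg_left (Real.exp_le_exp.mpr ?_) (mul_nonneg hC₉ (Real.exp_pos _).le)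
          have h1 : δ₀ / 2 * G.distD (e μ z) X ≤ δ₀ / 2 * (ρ (siteOf i) (e μ z) + w) :=
            mul_le_mul_of_nonneg_left (hwidth X i hi (e μ z)) (by linarith)
          rw [mul_add] at h1
          linarith
      _ = C₉ * Real.exp (δ₀ / 2 * w) * Real.exp (-δ₀ * (Nw : ℝ) / 2) * Real.exp (-(δ₀ / 2) * G.distD (e μ z) X) := by
          rw [Real.exp_add]; ring
      _ ≤ C₉ * Real.exp (δ₀ * w) * Real.exp (-δ₀ * (Nw : ℝ) / 2) * Real.exp (-(δ₀ / 2) * G.distD (e μ z) X) :=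
          mul_le_mul_of_nonneg_right (mul_le_mul_of_nonneg_right (mul_le_mul_of_nonneg_left h2 hC₉) (Real.exp_pos _).le) (Real.exp_pos _).le
  · rw [if_neg hi, if_neg hi]
    simpa using hR

/-- **PLACEHOLDER for the RESPONSE DATA of the record at one window point** (DEF-1's objects + the [15] Prop. 9 primitives PT-B consumes; model M1): per volume the bond type `Λ K` with the
torus metric `ρ K`, the window bond map `e K`, the coordinate sets `cX K X` of the domains with their sites, the response kernels `Gk K`, the unwrap data (`wrap`, `emb`, `jX`), and the four
print-side properties (kernel decay, two-volume comparison on the window, coordinate compatibility, coordinate width `w`). [cite: Balaban1985Variational, Prop. 9; Balaban1987RG1, (1.7) p.261, (1.21) p.264] -/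
structure ResponsePLACEHOLDER {E₀ κ α₂ : ℝ} (Φ : FmtPlusPinPLACEHOLDER E₀ κ) (Ch : BackgroundChartPLACEHOLDER Φ α₂) (N : ℕ → ℕ) (C₉ δ₀ w : ℝ) where
  Cc : (K : ℕ) → B12.CubeCover (Φ.S K)
  Λ : ℕ → Type
  G : (K : ℕ) → SiteGeometry (Cc K) (Λ K)
  ρ : (K : ℕ) → Λ K → Λ K → ℝ
  e : (K : ℕ) → Fin 4 → (Fin 4 → ℤ) → Λ K
  cX : (K : ℕ) → (Φ.S K).Dom → Finset (Fin (Ch.m K))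
  siteOf : (K : ℕ) → Fin (Ch.m K) → Λ K
  Gk : (K : ℕ) → Λ K → Fin (Ch.m K) → ℂ
  wrap : (K : ℕ) → Finset (Φ.S K).Dom
  emb : (K : ℕ) → (Φ.S K).Dom → (Φ.S (K + 1)).Dom
  jX : (K : ℕ) → (Φ.S K).Dom → Fin (Ch.m K) → Fin (Ch.m (K + 1))
  /-- configuration-coordinate restriction of the unwrap (print's (1.7) at the configuration level) -/
  πc : (K : ℕ) → (Φ.S K).Dom → (Fin (Φ.M (K + 1)) → ℂ) → (Fin (Φ.M K) → ℂ)
  C₉_nonneg : 0 ≤ C₉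
  δ₀_nonneg : 0 ≤ δ₀
  w_nonneg : 0 ≤ w
  /-- [15] Prop. 9: decay of the response kernel -/
  decay : ∀ K x i, ‖Gk K x i‖ ≤ C₉ * Real.exp (-δ₀ * ρ K (siteOf K i) x)
  /-- coordinates of a domain lie within `w` of it -/
  width : ∀ K X, ∀ i ∈ cX K X, ∀ x, (G K).distD x X ≤ ρ K (siteOf K i) x + w
  /-- coordinate compatibility of the unwrap -/
  compat : ∀ K X, X ∉ wrap K → ∀ i ∈ cX K X, jX K X i ∈ cX (K + 1) (emb K X)
  /-- [15] Prop. 9 + images: two-volume comparison of the kernels on the fundamental window -/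
  twoVol : ∀ K X, X ∉ wrap K → ∀ i ∈ cX K X, ∀ (μ : Fin 4) (z : Fin 4 → ℤ), (∀ l, 2 * |z l| < (N K : ℤ)) →
    ‖Gk (K + 1) (e (K + 1) μ z) (jX K X i) - Gk K (e K μ z) i‖ ≤ C₉ * Real.exp (-δ₀ * (N K : ℝ) / 2) * Real.exp (-(δ₀ / 2) * ρ K (siteOf K i) (e K μ z))
  /-- (1.7) + p.264 L19–20 at the configuration level: the piece of a non-wrapping domain on the larger torus IS the smaller torus's piece read through `π` -/
  volIndep : ∀ K X, X ∉ wrap K → ∀ u', Φ.E (K + 1) (emb K X) u' = Φ.E K X (πc K X u')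
  /-- chart intertwining (definitional for the exponential chart of a local field; DEF-1) -/
  intertwine : ∀ K X, X ∉ wrap K → ∀ w', πc K X (Ch.χ (K + 1) (emb K X) w') = Ch.χ K X (restrictCLM (cX K X) (jX K X) w')

/-- **PT-B (rec)** — the record-level reading of `PortPieceLocalityU8` over the placeholders: lens-1's :332 (plain decay), :338 (piece identity) and :339–:341 (restricted tail difference) for
the charted pieces, the cut responses and `T K X := restrictCLM`, with `B_h := C₉e^{δ₀w}`. [cite: Balaban1987RG1, (1.7) p.261, (1.21) p.264; Balaban1985Variational, Prop. 9] -/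
def PortPieceLocalityU8Rec {E₀ κ α₂ : ℝ} {Φ : FmtPlusPinPLACEHOLDER E₀ κ} {Ch : BackgroundChartPLACEHOLDER Φ α₂} {N : ℕ → ℕ} {C₉ δ₀ w : ℝ}
    (R : ResponsePLACEHOLDER Φ Ch N C₉ δ₀ w) : Prop :=
  ∀ K,
    (∀ X x, ‖cutResponse (R.cX K X) (R.Gk K) x‖ ≤ C₉ * Real.exp (δ₀ * w) * Real.exp (-δ₀ * (R.G K).distD x X)) ∧
    (∀ X, X ∉ R.wrap K → ∀ w', (Φ.E (K + 1) (R.emb K X) ∘ Ch.χ (K + 1) (R.emb K X)) w' = (Φ.E K X ∘ Ch.χ K X) (restrictCLM (R.cX K X) (R.jX K X) w')) ∧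
    (∀ X (μ : Fin 4) (z : Fin 4 → ℤ), X ∉ R.wrap K → (∀ i, 2 * |z i| < (N K : ℤ)) →
      ‖restrictCLM (R.cX K X) (R.jX K X) (cutResponse (R.cX (K + 1) (R.emb K X)) (R.Gk (K + 1)) (R.e (K + 1) μ z)) - cutResponse (R.cX K X) (R.Gk K) (R.e K μ z)‖
        ≤ C₉ * Real.exp (δ₀ * w) * Real.exp (-δ₀ * (N K : ℝ) / 2) * Real.exp (-(δ₀ / 2) * (R.G K).distD (R.e K μ z) X))

/-- PT-B (rec) from PT-B2a, PT-B1, PT-B2b (abs; kept as the parameter `hT` to display the dependency — discharged by `portResponseTailsU8_holds` in `portPieceLocalityU8Rec_holds`).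
[cite: Balaban1987RG1, (1.7) p.261, (1.21) p.264] -/
theorem portPieceLocalityU8Rec_of_tails (hT : PortResponseTailsU8) {E₀ κ α₂ : ℝ} {Φ : FmtPlusPinPLACEHOLDER E₀ κ} {Ch : BackgroundChartPLACEHOLDER Φ α₂}
    {N : ℕ → ℕ} {C₉ δ₀ w : ℝ} (R : ResponsePLACEHOLDER Φ Ch N C₉ δ₀ w) : PortPieceLocalityU8Rec R := by
  intro K
  refine ⟨fun X x => ?_, fun X hX w' => ?_, fun X μ z hX hz => ?_⟩
  · exact portResponseDecayU8_holds (Φ.S K) (R.Cc K) (R.Λ K) (R.G K) (R.ρ K) (Ch.m K) (R.cX K) (R.siteOf K) (R.Gk K) C₉ δ₀ w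
      R.C₉_nonneg R.δ₀_nonneg (R.decay K) (R.width K) X x
  · exact portPieceIdentityU8_holds _ _ _ _ _ _ (Φ.E K) (Φ.E (K + 1)) (Ch.χ K) (Ch.χ (K + 1)) (R.wrap K) (R.emb K) (R.πc K)
      (fun X => restrictCLM (R.cX K X) (R.jX K X)) (R.volIndep K) (R.intertwine K) X hX w'
  · exact hT (Φ.S K) (Φ.S (K + 1)) (R.Cc K) (R.Λ K) (R.Λ (K + 1)) (R.G K) (R.ρ K) (Ch.m K) (Ch.m (K + 1)) (R.cX K) (R.cX (K + 1)) (R.siteOf K)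
      (R.Gk K) (R.Gk (K + 1)) (R.wrap K) (R.emb K) (R.jX K) (R.e K) (R.e (K + 1)) (N K) C₉ δ₀ w R.C₉_nonneg R.δ₀_nonneg R.w_nonneg
      (R.compat K) (R.twoVol K) (R.width K) X μ z hX hz

/-- **PT-B (rec) HOLDS over the placeholders** (all three abstract parts proved). [cite: Balaban1987RG1, (1.7) p.261, (1.21) p.264; Balaban1985Variational, Prop. 9] -/
theorem portPieceLocalityU8Rec_holds {E₀ κ α₂ : ℝ} {Φ : FmtPlusPinPLACEHOLDER E₀ κ} {Ch : BackgroundChartPLACEHOLDER Φ α₂}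
    {N : ℕ → ℕ} {C₉ δ₀ w : ℝ} (R : ResponsePLACEHOLDER Φ Ch N C₉ δ₀ w) : PortPieceLocalityU8Rec R :=
  portPieceLocalityU8Rec_of_tails portResponseTailsU8_holds R

/-! ## §4  PT-A — `stmt-QuantumFields-27930 PortRecordRepresentationS1`
Print side: (S1) the merged new term (1.6) of the record IS the sum of its localized pieces ((1.7) p.261), as functionals of the unit-lattice field near the zero field — DEF-1's definitional
identity ON THE CARRIER (it cannot be typed before the carrier exists; it is the hypothesis `hS1` below); its READOUT consequence is calculus: the (1.20) tensor of the chart functional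
`B ↦ ℰ(exp ρB)` at `B = 0` is the sum of the pieces' tensors (twice `fderiv` of a finite sum of `C²` functions on a neighbourhood of `0`).  The second hypothesis of the readout — each
piece's tensor component `Π^{aa}_{X,μν}(x, y)` is `Re ∂²E_X(h^a_X(μ,x), h^a_X(ν,y))` — is print's (4.35) p.290 in the TREE's reading (`B12Decay510.kernelBound_of_repr435`'s `hrepr`): the located
residue ρ4 of the census (cruxidea-4's hunt), a binder here, never asserted. -/

/-- **PT-A (abs)** — candidate signature for `PortRecordRepresentationS1` (READOUT HALF): a localized representation of the chart functional near the zero field by `C²` pieces splits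
the (1.20) polarization tensor componentwise.  PROVED below (v0.1; S–M calculus: `fderiv` of a finite sum near a point, twice). [cite: Balaban1987RG1, (1.6)–(1.7) p.261, (1.20) p.264] -/
def PortRecordRepresentationS1 : Prop :=
  ∀ (Λ T : Type) [Fintype Λ] [Fintype T] [DecidableEq Λ] [DecidableEq T]
    (𝔄 : Type) [NormedRing 𝔄] [NormedAlgebra ℝ 𝔄] (V : Type) [NormedAddCommGroup V] [NormedSpace ℝ V] (ι : Type) [Fintype ι]
    (ℰ : (Λ → T → 𝔄) → ℝ) (ρ : V →L[ℝ] 𝔄) (bV : Module.Basis ι ℝ V)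
    (D : Type) [Fintype D] (g : D → (Λ → T → V) → ℝ) (U : Set (Λ → T → V)),
    U ∈ 𝓝 (0 : Λ → T → V) →
    (∀ B ∈ U, expChart ℰ ρ B = ∑ X, g X B) →
    (∀ X, ContDiffOn ℝ 2 (g X) U) →
    ∀ (μ ν : Λ) (x y : T) (a b : ι), polComp ℝ (expChart ℰ ρ) bV μ x a ν y b = ∑ X, polComp ℝ (g X) bV μ x a ν y b

/-- Calculus: the second derivative at `0` of a function that agrees on a neighbourhood of `0` with a finite sum of `C²` functions is the sum of their second derivatives
(`Filter.EventuallyEq.fderiv_eq` twice + `fderiv_sum`). [folklore] -/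
theorem fderiv_fderiv_eq_sum_of_eqOn {W : Type} [NormedAddCommGroup W] [NormedSpace ℝ W] {D : Type} [Fintype D]
    (f : W → ℝ) (g : D → W → ℝ) (U : Set W) (hU : U ∈ 𝓝 (0 : W)) (hS : ∀ B ∈ U, f B = ∑ X, g X B) (hg : ∀ X, ContDiffOn ℝ 2 (g X) U) :
    fderiv ℝ (fderiv ℝ f) 0 = ∑ X, fderiv ℝ (fderiv ℝ (g X)) 0 := by
  have hU0 : (0 : W) ∈ interior U := mem_interior_iff_mem_nhds.mpr hU
  have hcd : ∀ X, ∀ z ∈ interior U, ContDiffAt ℝ 2 (g X) z := fun X z hz =>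
    (hg X).contDiffAt (mem_interior_iff_mem_nhds.mp hz)
  have h1 : ∀ z ∈ interior U, fderiv ℝ f z = ∑ X, fderiv ℝ (g X) z := by
    intro z hz
    have hev : f =ᶠ[𝓝 z] fun B => ∑ X, g X B :=
      Filter.eventually_of_mem (isOpen_interior.mem_nhds hz) fun B hB => hS B (interior_subset hB)
    have hfun : (fun B => ∑ X, g X B) = ∑ X, g X := by funext B; simp [Finset.sum_apply]
    rw [hev.fderiv_eq, hfun]
    exact fderiv_sum fun X _ => (hcd X z hz).differentiableAt (by norm_num)
  have h2 : fderiv ℝ f =ᶠ[𝓝 0] fun z => ∑ X, fderiv ℝ (g X) z :=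
    Filter.eventually_of_mem (isOpen_interior.mem_nhds hU0) h1
  have hfun' : (fun z => ∑ X, fderiv ℝ (g X) z) = ∑ X, fderiv ℝ (g X) := by funext z; simp [Finset.sum_apply]
  rw [h2.fderiv_eq, hfun']
  exact fderiv_sum fun X _ => ((hcd X 0 hU0).fderiv_right (m := 1) (by norm_num)).differentiableAt (by norm_num)

/-- **PT-A (abs) HOLDS** (v0.1). Size S–M; the content at the record is DEF-1's (S1) on the carrier near the zero field and the (4.35) reading (H435, ρ4), both binders of the glue below.
[cite: Balaban1987RG1, (1.6)–(1.7) p.261, (1.20) p.264] -/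
theorem portRecordRepresentationS1_holds : PortRecordRepresentationS1 := by
  intro Λ T _ _ _ _ 𝔄 _ _ V _ _ ι _ ℰ ρ bV D _ g U hU hS1 hg μ ν x y a b
  have h3 := fderiv_fderiv_eq_sum_of_eqOn (expChart ℰ ρ) g U hU hS1 hg
  simp only [polComp, polTensor, h3, FunLike.coe_sum, Finset.sum_apply]

/-- **PT-A glue (abs)** — the trace (1.21)₁ and the (4.35) reading compose the readout: IF the tensor splits over the pieces (PT-A's conclusion) and each piece's diagonal component is the
bilinear (4.35) value on the responses, THEN the scalar kernel is `(dim 𝔤)⁻¹ Σ_a Σ_X Re ∂²E_X(h^a_X(μ,x), h^a_X(ν,y))` — lens-1's representation clause up to the reindexing of the pieces by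
`Dom × ι` (DEF-1: `E_{(X,a)} := (dim 𝔤)⁻¹·E_X`, `h_{(X,a)} := h^a_X`, `d(X,a) := d(X)`). PROVED (rewrites). [cite: Balaban1987RG1, (1.20)–(1.21) p.264, (4.35) p.290] -/
theorem polScalar_eq_of_split_of_repr435 {Λ T : Type} [Fintype Λ] [Fintype T] [DecidableEq Λ] [DecidableEq T]
    {𝔄 : Type} [NormedRing 𝔄] [NormedAlgebra ℝ 𝔄] {V : Type} [NormedAddCommGroup V] [NormedSpace ℝ V] {ι : Type} [Fintype ι]
    (ℰ : (Λ → T → 𝔄) → ℝ) (ρ : V →L[ℝ] 𝔄) (bV : Module.Basis ι ℝ V)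
    {D : Type} [Fintype D] (g : D → (Λ → T → V) → ℝ) {m : ℕ} (EX : D → (Fin m → ℂ) → ℂ) (h : ι → D → Λ × T → (Fin m → ℂ))
    (μ ν : Λ) (x y : T)
    (hsplit : ∀ a, polComp ℝ (expChart ℰ ρ) bV μ x a ν y a = ∑ X, polComp ℝ (g X) bV μ x a ν y a)
    (h435 : ∀ a X, polComp ℝ (g X) bV μ x a ν y a = (mixedDeriv (EX X) (h a X (μ, x)) (h a X (ν, y))).re) :
    polScalar ℰ ρ bV μ x ν y = (Fintype.card ι : ℝ)⁻¹ * ∑ a, ∑ X, (mixedDeriv (EX X) (h a X (μ, x)) (h a X (ν, y))).re := by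
  unfold polScalar
  congr 1
  refine Finset.sum_congr rfl fun a _ => ?_
  rw [hsplit a]
  exact Finset.sum_congr rfl fun X _ => h435 a X

/-! ## §5  The SHARED DATA of one window point and the seven predicate groups of `N3PairShapeAt` (R2: chosen ONCE per `(k, v)`, above `∀ K μ ν z`) -/

/-- `N3PairShapeAt`'s ∃-prefix as a structure: the localization ∕ geometry ∕ response data of ONE window point, every volume. [cite: Balaban1987RG1, (1.7) p.261, (4.35) p.290] -/
structure PairData where
  S : ℕ → LocDomainSys
  Cc : (K : ℕ) → B12.CubeCover (S K)
  Λ : ℕ → Type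
  G : (K : ℕ) → SiteGeometry (Cc K) (Λ K)
  ρ : (K : ℕ) → Λ K → Λ K → ℝ
  m : ℕ → ℕ
  EX : (K : ℕ) → (S K).Dom → (Fin (m K) → ℂ) → ℂ
  h : (K : ℕ) → (S K).Dom → Λ K → (Fin (m K) → ℂ)
  e : (K : ℕ) → Fin 4 → (Fin 4 → ℤ) → Λ K
  wrap : (K : ℕ) → Finset (S K).Dom
  emb : (K : ℕ) → (S K).Dom → (S (K + 1)).Dom
  T : (K : ℕ) → (S K).Dom → ((Fin (m (K + 1)) → ℂ) →L[ℂ] (Fin (m K) → ℂ))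

namespace PairData

variable (d : PairData)

/-- Group C (PT-C's output): row E. [cite: Balaban1987RG1, (1.18) p.263] -/
def RowC (α₂ E₀ κ : ℝ) (K : ℕ) : Prop := RowE118 (d.S K) (d.EX K) α₂ E₀ κ

/-- Group B2a (PT-B's output): plain response decay :332. [cite: Balaban1985Variational, Prop. 9] -/
def DecayB (Bh δ₀ : ℝ) (K : ℕ) : Prop := ∀ X x, ‖d.h K X x‖ ≤ Bh * Real.exp (-δ₀ * (d.G K).distD x X)

/-- Group L (DEF-1, lattice leaves of the record's cube geometry at the engine's rates and the halved rates). [cite: Balaban1987RG1, (0.26) pp.257–258, (5.10) p.293] -/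
def LeavesL (κ δ₀ M c₁ K₀ K₁ K₀' K₁' : ℝ) (K : ℕ) : Prop :=
  GeomLeaf (d.G K) (d.ρ K) M c₁ ∧ CubeSumLeaf (d.G K) (δ₀ / 2) K₁ ∧ TreeLeaf (d.Cc K) (κ / 2) K₀ ∧
    CubeSumLeaf (d.G K) (δ₀ / 2 / 2) K₁' ∧ TreeLeaf (d.Cc K) (κ / 2 / 2) K₀'

open Classical in
/-- Group G (DEF-1, unwrap geometry of consecutive tori: injective off the wrap class, wrapping ∕ unmatched domains far). [cite: Balaban1987RG1, (1.21) p.264] -/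
def UnwrapG (N : ℕ → ℕ → ℕ) (M : ℝ) (k K : ℕ) : Prop :=
  Set.InjOn (d.emb K) ((d.wrap K)ᶜ : Finset (d.S K).Dom) ∧
    (∀ X ∈ d.wrap K, (N k K : ℝ) / M ≤ (d.S K).dj X) ∧
    (∀ Y : (d.S (K + 1)).Dom, (∀ X, X ∉ d.wrap K → d.emb K X ≠ Y) → (N k K : ℝ) / M ≤ (d.S (K + 1)).dj Y)

/-- Group B1 (PT-B's output): piece identity off the wrap class :338. [cite: Balaban1987RG1, (1.7) p.261] -/
def PieceB (K : ℕ) : Prop := ∀ X, X ∉ d.wrap K → ∀ w, d.EX (K + 1) (d.emb K X) w = d.EX K X (d.T K X w)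

open Classical in
/-- Group B2b (PT-B's output): restricted response-tail difference on the window :339–:341. [cite: Balaban1985Variational, Prop. 9; Balaban1987RG1, (1.21) p.264] -/
def TailsB (N : ℕ → ℕ → ℕ) (Bh δ₀ : ℝ) (k K : ℕ) : Prop :=
  ∀ X (μ : Fin 4) (z : Fin 4 → ℤ), X ∉ d.wrap K → (∀ i, 2 * |z i| < (N k K : ℤ)) →
    ‖d.T K X (d.h (K + 1) (d.emb K X) (d.e (K + 1) μ z)) - d.h K X (d.e K μ z)‖
      ≤ Bh * Real.exp (-δ₀ * (N k K : ℝ) / 2) * Real.exp (-(δ₀ / 2) * (d.G K).distD (d.e K μ z) X)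

open Classical in
/-- Group A∕W (PT-A's output + DEF-1's window geometry): on the window, `ρ(e μ 0, e ν z) = ‖z‖₁` and the representation of the kernel by the pieces. [cite: Balaban1987RG1, (1.20)–(1.21) p.264, (4.35) p.290] -/
def ReprA (N : ℕ → ℕ → ℕ) (Pk : (k : ℕ) → (Fin (k + 1) → ℝ) → ℕ → Fin 4 → Fin 4 → (Fin 4 → ℤ) → ℝ) (k : ℕ) (v : Fin (k + 1) → ℝ) (K : ℕ) : Prop :=
  ∀ (μ ν : Fin 4) (z : Fin 4 → ℤ), (∀ i, 2 * |z i| < (N k K : ℤ)) →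
    d.ρ K (d.e K μ 0) (d.e K ν z) = l1 z ∧
    Pk k v K μ ν z = ∑ X, (mixedDeriv (d.EX K X) (d.h K X (d.e K μ 0)) (d.h K X (d.e K ν z))).re

/-- All seven groups, every volume. [cite: Balaban1987RG1, (1.7) p.261, (1.18) p.263, (1.21) p.264, (4.35) p.290] -/
def Ported (N : ℕ → ℕ → ℕ) (Pk : (k : ℕ) → (Fin (k + 1) → ℝ) → ℕ → Fin 4 → Fin 4 → (Fin 4 → ℤ) → ℝ)
    (α₂ E₀ Bh κ δ₀ M c₁ K₀ K₁ K₀' K₁' : ℝ) (k : ℕ) (v : Fin (k + 1) → ℝ) : Prop :=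
  ∀ K, d.RowC α₂ E₀ κ K ∧ d.DecayB Bh δ₀ K ∧ d.LeavesL κ δ₀ M c₁ K₀ K₁ K₀' K₁' K ∧ d.UnwrapG N M k K ∧ d.PieceB K ∧ d.TailsB N Bh δ₀ k K ∧ d.ReprA N Pk k v K

end PairData

/-- **THE GROUPS TILE THE SHAPE** (kernel check of the bookkeeping): shared data carrying the seven groups at every volume inhabit `N3PairShapeAt` at the window point. 0 sorry.
[cite: Balaban1987RG1, (1.7) p.261, (1.18) p.263, (1.21) p.264, (4.35) p.290] -/
theorem n3PairShapeAt_of_ported (d : PairData) {N : ℕ → ℕ → ℕ} {Pk : (k : ℕ) → (Fin (k + 1) → ℝ) → ℕ → Fin 4 → Fin 4 → (Fin 4 → ℤ) → ℝ}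
    {α₂ E₀ Bh κ δ₀ M c₁ K₀ K₁ K₀' K₁' : ℝ} {k : ℕ} {v : Fin (k + 1) → ℝ} (H : d.Ported N Pk α₂ E₀ Bh κ δ₀ M c₁ K₀ K₁ K₀' K₁' k v) :
    N3PairShapeAt N Pk α₂ E₀ Bh κ δ₀ M c₁ K₀ K₁ K₀' K₁' k v := by
  refine ⟨d.S, d.Cc, d.Λ, d.G, d.ρ, d.m, d.EX, d.h, d.e, d.wrap, d.emb, d.T, fun K => ?_⟩
  obtain ⟨hC, hB, ⟨hL1, hL2, hL3, hL4, hL5⟩, ⟨hG1, hG2, hG3⟩, hP, hT, hA⟩ := H K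
  exact ⟨hC, hB, hL1, hL2, hL3, hL4, hL5, hG1, hG2, hG3, hP, hT, hA⟩

/-- Conversely the shape IS shared data with the seven groups (so the grouping loses nothing). [cite: Balaban1987RG1, (1.7) p.261] -/
theorem ported_of_n3PairShapeAt {N : ℕ → ℕ → ℕ} {Pk : (k : ℕ) → (Fin (k + 1) → ℝ) → ℕ → Fin 4 → Fin 4 → (Fin 4 → ℤ) → ℝ}
    {α₂ E₀ Bh κ δ₀ M c₁ K₀ K₁ K₀' K₁' : ℝ} {k : ℕ} {v : Fin (k + 1) → ℝ} (H : N3PairShapeAt N Pk α₂ E₀ Bh κ δ₀ M c₁ K₀ K₁ K₀' K₁' k v) :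
    ∃ d : PairData, d.Ported N Pk α₂ E₀ Bh κ δ₀ M c₁ K₀ K₁ K₀' K₁' k v := by
  obtain ⟨S, Cc, Λ, G, ρ, m, EX, h, e, wrap, emb, T, hK⟩ := H
  refine ⟨⟨S, Cc, Λ, G, ρ, m, EX, h, e, wrap, emb, T⟩, fun K => ?_⟩
  obtain ⟨hC, hB, hL1, hL2, hL3, hL4, hL5, hG1, hG2, hG3, hP, hT, hA⟩ := hK K
  exact ⟨hC, hB, ⟨hL1, hL2, hL3, hL4, hL5⟩, ⟨hG1, hG2, hG3⟩, hP, hT, hA⟩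

/-! ## §7  FROM THE PLACEHOLDERS TO THE GROUPS at one window point: which port supplies which group (the record-level suppliers) -/

/-- **The PairData of the placeholders** (model M1): charted pieces, cut responses, coordinate restrictions. [cite: Balaban1987RG1, (1.7) p.261, (4.35) p.290] -/
def pairDataOf {E₀ κ α₂ : ℝ} (Φ : FmtPlusPinPLACEHOLDER E₀ κ) (Ch : BackgroundChartPLACEHOLDER Φ α₂) {N : ℕ → ℕ} {C₉ δ₀ w : ℝ}
    (R : ResponsePLACEHOLDER Φ Ch N C₉ δ₀ w) : PairData where
  S := Φ.S
  Cc := R.Cc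
  Λ := R.Λ
  G := R.G
  ρ := R.ρ
  m := Ch.m
  EX K X := Φ.E K X ∘ Ch.χ K X
  h K X := cutResponse (R.cX K X) (R.Gk K)
  e := R.e
  wrap := R.wrap
  emb := R.emb
  T K X := restrictCLM (R.cX K X) (R.jX K X)

/-- **★ THE SUPPLIERS, kernel-composed at one window point**: `Fmt⁺`-placeholder (Thm 3's (1.18) + analyticity) and the chart ⟹ group C [PT-C, PROVED]; the response placeholder ⟹ groups
B2a [PROVED], B1 [PROVED], B2b [GIVEN PT-B2b (abs) = `hT`]; groups L, G (DEF-1's lattice ∕ unwrap facts) and A∕W (PT-A's readout + (4.35) + window geometry) enter as the binders `hL`, `hG`,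
`hA` on the SAME data.  Conclusion: the seven groups, i.e. (§5) `N3PairShapeAt` at the window point for `N k' K := N K`. 0 sorry. [cite: Balaban1987RG1, (1.7) p.261, (1.18) p.263, (1.21) p.264, (4.35) p.290] -/
theorem ported_pairDataOf (hT : PortResponseTailsU8) {E₀ κ α₂ : ℝ} (Φ : FmtPlusPinPLACEHOLDER E₀ κ) (Ch : BackgroundChartPLACEHOLDER Φ α₂)
    (N : ℕ → ℕ → ℕ) (k : ℕ) {C₉ δ₀ w : ℝ} (R : ResponsePLACEHOLDER Φ Ch (N k) C₉ δ₀ w)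
    (Pk : (k : ℕ) → (Fin (k + 1) → ℝ) → ℕ → Fin 4 → Fin 4 → (Fin 4 → ℤ) → ℝ) (v : Fin (k + 1) → ℝ) {M c₁ K₀ K₁ K₀' K₁' : ℝ}
    (hL : ∀ K, (pairDataOf Φ Ch R).LeavesL κ δ₀ M c₁ K₀ K₁ K₀' K₁' K)
    (hG : ∀ K, (pairDataOf Φ Ch R).UnwrapG N M k K)
    (hA : ∀ K, (pairDataOf Φ Ch R).ReprA N Pk k v K) :
    (pairDataOf Φ Ch R).Ported N Pk α₂ E₀ (C₉ * Real.exp (δ₀ * w)) κ δ₀ M c₁ K₀ K₁ K₀' K₁' k v := by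
  intro K
  obtain ⟨hB2a, hB1, hB2b⟩ := portPieceLocalityU8Rec_of_tails hT R K
  exact ⟨portRowE118U2Rec_holds Φ Ch K, hB2a, hL K, hG K, hB1, hB2b, hA K⟩

/-- **★★ ONE WINDOW POINT, END TO END**: placeholders + PT-B2b + the DEF-1 ∕ PT-A binders ⟹ `N3PairShapeAt` there (with `B_h := C₉e^{δ₀w}`). 0 sorry.
[cite: Balaban1987RG1, (1.7) p.261, (1.18) p.263, (1.21) p.264, (4.35) p.290] -/
theorem n3PairShapeAt_of_placeholders (hT : PortResponseTailsU8) {E₀ κ α₂ : ℝ} (Φ : FmtPlusPinPLACEHOLDER E₀ κ) (Ch : BackgroundChartPLACEHOLDER Φ α₂)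
    (N : ℕ → ℕ → ℕ) (k : ℕ) {C₉ δ₀ w : ℝ} (R : ResponsePLACEHOLDER Φ Ch (N k) C₉ δ₀ w)
    (Pk : (k : ℕ) → (Fin (k + 1) → ℝ) → ℕ → Fin 4 → Fin 4 → (Fin 4 → ℤ) → ℝ) (v : Fin (k + 1) → ℝ) {M c₁ K₀ K₁ K₀' K₁' : ℝ}
    (hL : ∀ K, (pairDataOf Φ Ch R).LeavesL κ δ₀ M c₁ K₀ K₁ K₀' K₁' K)
    (hG : ∀ K, (pairDataOf Φ Ch R).UnwrapG N M k K)
    (hA : ∀ K, (pairDataOf Φ Ch R).ReprA N Pk k v K) :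
    N3PairShapeAt N Pk α₂ E₀ (C₉ * Real.exp (δ₀ * w)) κ δ₀ M c₁ K₀ K₁ K₀' K₁' k v :=
  n3PairShapeAt_of_ported _ (ported_pairDataOf hT Φ Ch N k R Pk v hL hG hA)

/-- **★★ ONE WINDOW POINT, the three ports discharged**: placeholders + the DEF-1 ∕ PT-A binders `hL hG hA` ⟹ `N3PairShapeAt`. 0 sorry; axioms standard.
[cite: Balaban1987RG1, (1.7) p.261, (1.18) p.263, (1.21) p.264, (4.35) p.290] -/
theorem n3PairShapeAt_of_placeholders' {E₀ κ α₂ : ℝ} (Φ : FmtPlusPinPLACEHOLDER E₀ κ) (Ch : BackgroundChartPLACEHOLDER Φ α₂)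
    (N : ℕ → ℕ → ℕ) (k : ℕ) {C₉ δ₀ w : ℝ} (R : ResponsePLACEHOLDER Φ Ch (N k) C₉ δ₀ w)
    (Pk : (k : ℕ) → (Fin (k + 1) → ℝ) → ℕ → Fin 4 → Fin 4 → (Fin 4 → ℤ) → ℝ) (v : Fin (k + 1) → ℝ) {M c₁ K₀ K₁ K₀' K₁' : ℝ}
    (hL : ∀ K, (pairDataOf Φ Ch R).LeavesL κ δ₀ M c₁ K₀ K₁ K₀' K₁' K)
    (hG : ∀ K, (pairDataOf Φ Ch R).UnwrapG N M k K)
    (hA : ∀ K, (pairDataOf Φ Ch R).ReprA N Pk k v K) :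
    N3PairShapeAt N Pk α₂ E₀ (C₉ * Real.exp (δ₀ * w)) κ δ₀ M c₁ K₀ K₁ K₀' K₁' k v :=
  n3PairShapeAt_of_placeholders portResponseTailsU8_holds Φ Ch N k R Pk v hL hG hA

/-! ## §10  DATA ∕ OBLIGATION SPLIT (v0.3) — the placeholders UN-BUNDLED («never smuggle existence into the interface»)
Each PLACEHOLDER structure of §2–§3 bundles DATA (which DEF-1 can DEFINE for the record today: domains, coordinates, pieces-as-functions, charts, response kernels, unwrap maps) with
PRINT-SIDE OBLIGATIONS (which are THEOREMS about that data: analyticity + (1.18) = typer-1's T1; chart containment = [I] (3.36)–(3.54); Prop-9 decay + two-volume comparison = [15]).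
§10 separates them: `FmtData ∕ ChartData ∕ ResponseData` (pure data, no proofs) and `FmtObligations ∕ ChartObligations ∕ ResponseObligations : Prop`.  Consequences:
 • the F2 «re-purpose to primitives» reading of №417 gets TEXTS: `T1 := FmtObligations (recordFmtData …) E₀ κ`, `27932′ := ChartObligations (recordChartData …) α₂`,
   `27931′ := ResponseObligations (recordResponseData …) (N k) C₉ δ₀ w` — settable the moment DEF-1's three `record…Data` DEFINITIONS land (they need no theorem);
 • `n3PairShapeAt_of_obligations`: data + the three obligation Props + the binders `hL hG hA` (stated over the DATA-ONLY `pairDataOfData`, no proof terms in their types) ⟹ `N3PairShapeAt`;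
 • the toy of §9 re-read through the split (`toy_obligations`), rule (N) for §10.  0 sorry. -/

/-- DATA of the `Fmt⁺` pin at one window point (no proofs): domain systems, coordinate counts, pieces, complex spaces. [cite: Balaban1987RG1, (1.11)–(1.18) pp.262–263] -/
structure FmtData where
  S : ℕ → LocDomainSys
  M : ℕ → ℕ
  E : (K : ℕ) → (S K).Dom → (Fin (M K) → ℂ) → ℂ
  Uc : (K : ℕ) → (S K).Dom → Set (Fin (M K) → ℂ)

/-- **T1's THEOREM SHAPE** (the print-side obligations of the pin): analyticity on `U^c` and (1.18) with ABSOLUTE constants. [cite: Balaban1987RG1, p.261 L37, (1.18) p.263] -/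
def FmtObligations (D : FmtData) (E₀ κ : ℝ) : Prop :=
  (∀ K X, AnalyticOnNhd ℂ (D.E K X) (D.Uc K X)) ∧ ∀ K X, ∀ u ∈ D.Uc K X, ‖D.E K X u‖ ≤ E₀ * Real.exp (-κ * (D.S K).dj X)

/-- re-bundle -/
def FmtData.pin (D : FmtData) {E₀ κ : ℝ} (h : FmtObligations D E₀ κ) : FmtPlusPinPLACEHOLDER E₀ κ where
  S := D.S
  M := D.M
  E := D.E
  Uc := D.Uc
  analytic := h.1
  bound118 := h.2

/-- DATA of the background chart (no proofs). [cite: Balaban1987RG1, (3.36)–(3.54) pp.277–280] -/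
structure ChartData (D : FmtData) where
  m : ℕ → ℕ
  χ : (K : ℕ) → (D.S K).Dom → (Fin (m K) → ℂ) → (Fin (D.M K) → ℂ)

/-- **27932′ SHAPE** (F2 re-purpose): the chart is entire and maps the `α₂`-ball into `U^c`. [cite: Balaban1987RG1, (3.36)–(3.54) pp.277–280] -/
def ChartObligations {D : FmtData} (C : ChartData D) (α₂ : ℝ) : Prop :=
  (∀ K X, AnalyticOnNhd ℂ (C.χ K X) Set.univ) ∧ ∀ K X, Set.MapsTo (C.χ K X) (ball 0 α₂) (D.Uc K X)

/-- re-bundle -/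
def ChartData.chart {D : FmtData} (C : ChartData D) {E₀ κ α₂ : ℝ} (hD : FmtObligations D E₀ κ) (hC : ChartObligations C α₂) :
    BackgroundChartPLACEHOLDER (D.pin hD) α₂ where
  m := C.m
  χ := C.χ
  entire := hC.1
  mapsTo := hC.2

/-- DATA of the response at one window point (no proofs): cube covers, bonds, site geometry, torus metric, window bond map, coordinate sets and sites, response kernels, unwrap maps.
[cite: Balaban1985Variational, Prop. 9; Balaban1987RG1, (1.7) p.261, (1.21) p.264] -/
structure ResponseData (D : FmtData) (C : ChartData D) where
  Cc : (K : ℕ) → B12.CubeCover (D.S K)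
  Λ : ℕ → Type
  G : (K : ℕ) → SiteGeometry (Cc K) (Λ K)
  ρ : (K : ℕ) → Λ K → Λ K → ℝ
  e : (K : ℕ) → Fin 4 → (Fin 4 → ℤ) → Λ K
  cX : (K : ℕ) → (D.S K).Dom → Finset (Fin (C.m K))
  siteOf : (K : ℕ) → Fin (C.m K) → Λ K
  Gk : (K : ℕ) → Λ K → Fin (C.m K) → ℂ
  wrap : (K : ℕ) → Finset (D.S K).Dom
  emb : (K : ℕ) → (D.S K).Dom → (D.S (K + 1)).Dom
  jX : (K : ℕ) → (D.S K).Dom → Fin (C.m K) → Fin (C.m (K + 1))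
  πc : (K : ℕ) → (D.S K).Dom → (Fin (D.M (K + 1)) → ℂ) → (Fin (D.M K) → ℂ)

/-- **27931′ SHAPE** (F2 re-purpose): the print-side obligations of the response data — [15] Prop. 9 decay, coordinate width, unwrap compatibility, two-volume comparison on the window,
configuration-level volume independence (1.7), chart intertwining. [cite: Balaban1985Variational, Prop. 9; Balaban1987RG1, (1.7) p.261, (1.21) p.264] -/
def ResponseObligations {D : FmtData} {C : ChartData D} (R : ResponseData D C) (N : ℕ → ℕ) (C₉ δ₀ w : ℝ) : Prop :=
  0 ≤ C₉ ∧ 0 ≤ δ₀ ∧ 0 ≤ w ∧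
  (∀ K x i, ‖R.Gk K x i‖ ≤ C₉ * Real.exp (-δ₀ * R.ρ K (R.siteOf K i) x)) ∧
  (∀ K X, ∀ i ∈ R.cX K X, ∀ x, (R.G K).distD x X ≤ R.ρ K (R.siteOf K i) x + w) ∧
  (∀ K X, X ∉ R.wrap K → ∀ i ∈ R.cX K X, R.jX K X i ∈ R.cX (K + 1) (R.emb K X)) ∧
  (∀ K X, X ∉ R.wrap K → ∀ i ∈ R.cX K X, ∀ (μ : Fin 4) (z : Fin 4 → ℤ), (∀ l, 2 * |z l| < (N K : ℤ)) →
    ‖R.Gk (K + 1) (R.e (K + 1) μ z) (R.jX K X i) - R.Gk K (R.e K μ z) i‖ ≤ C₉ * Real.exp (-δ₀ * (N K : ℝ) / 2) * Real.exp (-(δ₀ / 2) * R.ρ K (R.siteOf K i) (R.e K μ z))) ∧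
  (∀ K X, X ∉ R.wrap K → ∀ u', D.E (K + 1) (R.emb K X) u' = D.E K X (R.πc K X u')) ∧
  (∀ K X, X ∉ R.wrap K → ∀ w', R.πc K X (C.χ (K + 1) (R.emb K X) w') = C.χ K X (restrictCLM (R.cX K X) (R.jX K X) w'))

/-- re-bundle -/
def ResponseData.response {D : FmtData} {C : ChartData D} (R : ResponseData D C) {E₀ κ α₂ : ℝ} (hD : FmtObligations D E₀ κ) (hC : ChartObligations C α₂)
    {N : ℕ → ℕ} {C₉ δ₀ w : ℝ} (hR : ResponseObligations R N C₉ δ₀ w) : ResponsePLACEHOLDER (D.pin hD) (C.chart hD hC) N C₉ δ₀ w where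
  Cc := R.Cc
  Λ := R.Λ
  G := R.G
  ρ := R.ρ
  e := R.e
  cX := R.cX
  siteOf := R.siteOf
  Gk := R.Gk
  wrap := R.wrap
  emb := R.emb
  jX := R.jX
  πc := R.πc
  C₉_nonneg := hR.1
  δ₀_nonneg := hR.2.1
  w_nonneg := hR.2.2.1
  decay := hR.2.2.2.1
  width := hR.2.2.2.2.1
  compat := hR.2.2.2.2.2.1
  twoVol := hR.2.2.2.2.2.2.1
  volIndep := hR.2.2.2.2.2.2.2.1
  intertwine := hR.2.2.2.2.2.2.2.2

/-- the `PairData` of §5 read off the DATA alone (no proof terms) — the carrier over which `hL hG hA` are stated -/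
def pairDataOfData (D : FmtData) (C : ChartData D) (R : ResponseData D C) : PairData where
  S := D.S
  Cc := R.Cc
  Λ := R.Λ
  G := R.G
  ρ := R.ρ
  m := C.m
  EX K X := D.E K X ∘ C.χ K X
  h K X := cutResponse (R.cX K X) (R.Gk K)
  e := R.e
  wrap := R.wrap
  emb := R.emb
  T K X := restrictCLM (R.cX K X) (R.jX K X)

/-- the re-bundled placeholders carry the same `PairData` (definitional). -/
theorem pairDataOf_rebundle (D : FmtData) (C : ChartData D) (R : ResponseData D C) {E₀ κ α₂ : ℝ} (hD : FmtObligations D E₀ κ) (hC : ChartObligations C α₂)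
    {N : ℕ → ℕ} {C₉ δ₀ w : ℝ} (hR : ResponseObligations R N C₉ δ₀ w) :
    pairDataOf (D.pin hD) (C.chart hD hC) (R.response hD hC hR) = pairDataOfData D C R := rfl

/-- **★ THE SPLIT COMPOSITION**: DATA + the three OBLIGATION Props (T1-shape, 27932′-shape, 27931′-shape) + the binders `hL hG hA` over the data-only carrier ⟹ `N3PairShapeAt` at the window
point — through §7, i.e. through the three ports PT-A∕PT-B∕PT-C.  0 sorry. [cite: Balaban1987RG1, (1.7) p.261, (1.18) p.263, (1.21) p.264, (4.35) p.290; Balaban1985Variational, Prop. 9] -/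
theorem n3PairShapeAt_of_obligations (D : FmtData) (C : ChartData D) (R : ResponseData D C) {E₀ κ α₂ C₉ δ₀ w : ℝ} (N : ℕ → ℕ → ℕ) (k : ℕ)
    (hD : FmtObligations D E₀ κ) (hC : ChartObligations C α₂) (hR : ResponseObligations R (N k) C₉ δ₀ w)
    {M c₁ K₀ K₁ K₀' K₁' : ℝ} (Pk : (k' : ℕ) → (Fin (k' + 1) → ℝ) → ℕ → Fin 4 → Fin 4 → (Fin 4 → ℤ) → ℝ) (v : Fin (k + 1) → ℝ)
    (hL : ∀ K, (pairDataOfData D C R).LeavesL κ δ₀ M c₁ K₀ K₁ K₀' K₁' K)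
    (hG : ∀ K, (pairDataOfData D C R).UnwrapG N M k K)
    (hA : ∀ K, (pairDataOfData D C R).ReprA N Pk k v K) :
    N3PairShapeAt N Pk α₂ E₀ (C₉ * Real.exp (δ₀ * w)) κ δ₀ M c₁ K₀ K₁ K₀' K₁' k v :=
  n3PairShapeAt_of_placeholders' (D.pin hD) (C.chart hD hC) N k (R.response hD hC hR) Pk v hL hG hA

/-! ## §11  RULE (v) GUARDS FOR THE (S1) ∕ T1 TYPING (director-ym №426; CRIT-1 sheet 3e0a4bdc69f0f040 §3): the piece index is THE RECORD's 𝐃_{k+1}, not a free type;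
pieces are LOCAL in their domain's coordinates ((1.7) p.261 L21); (S1) is stated over that fixed index.  The one-piece junk decomposition `Dom := Unit, g () := expChart ℰ ρ` is then
UNTYPEABLE (the index is `TDom 4 (domCount …)`); the remaining junk «one domain carries the whole functional, the others 0» is what `FmtLocality` + (1.18) (`FmtObligations`) jointly
exclude — which is the print's content (Thm 3), not a typing trick.  Record instantiation (`Φf K := B ↦ ℰ_K(exp ρ_K B)` over `kerZB`'s θ, `ι K :=` DEF-1's coordinate embedding) is
PT-E's one-liner; nothing of it is asserted here. -/

/-- `Fmt⁺` DATA OVER A FIXED domain-system family `S` (for the record: `S := recordDomSys F Mc k`), with the coordinate sets of the domains. [cite: Balaban1987RG1, p.257 (𝐃_j), (1.7) p.261, (1.11)–(1.18) pp.262–263] -/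
structure FmtDataOver (S : ℕ → LocDomainSys) where
  M : ℕ → ℕ
  E : (K : ℕ) → (S K).Dom → (Fin (M K) → ℂ) → ℂ
  Uc : (K : ℕ) → (S K).Dom → Set (Fin (M K) → ℂ)
  /-- the configuration coordinates «in X» (bonds of the fine lattice inside `domSites X`, DEF-1) -/
  coordsOf : (K : ℕ) → (S K).Dom → Finset (Fin (M K))

/-- forget the index constraint -/
def FmtDataOver.toFmtData {S : ℕ → LocDomainSys} (D : FmtDataOver S) : FmtData where
  S := S
  M := D.M
  E := D.E
  Uc := D.Uc

/-- (1.7) p.261 L21 «the term corresponding to a domain X depends on U_j restricted to X», in coordinates: `E K X` factors through the coordinates of `X`. [cite: Balaban1987RG1, (1.7) p.261] -/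
def FmtLocality {S : ℕ → LocDomainSys} (D : FmtDataOver S) : Prop :=
  ∀ K X u u', (∀ i ∈ D.coordsOf K X, u i = u' i) → D.E K X u = D.E K X u'

/-- **THE RECORD's INDEX**: `𝐃_{k+1}` of `T^{(K)}` with `Mc`-cubes = `Node00.Sect2.domSys (F.P K) Mc (k+1)` (tree: torus catalogue `TreeLengthTorus.tsys`, `d_{k+1} = torusTreeLen`).
[cite: Balaban1987RG1, p.257 (class 𝐃_j, d_j(X))] -/
abbrev recordDomSys (F : T4Family) (Mc k : ℕ) : ℕ → LocDomainSys := fun K => Sect2.domSys (F.P K) Mc (k + 1)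

/-- **T1's THEOREM SHAPE over the record's index** = (1.18) + analyticity (`FmtObligations`) AND coordinate locality (1.7). [cite: Balaban1987RG1, (1.7) p.261, (1.18) p.263] -/
def FmtObligationsOver {S : ℕ → LocDomainSys} (D : FmtDataOver S) (E₀ κ : ℝ) : Prop :=
  FmtObligations D.toFmtData E₀ κ ∧ FmtLocality D

/-- **(S1) OVER THE FIXED INDEX** (27930′ shape): a functional family `Φf K : W K → ℂ` is, near `0`, the finite sum over the domains `X ∈ S K` of the charted pieces read through the
coordinate embedding `ι K`. [cite: Balaban1987RG1, (1.6)–(1.7) p.261] -/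
def ReprS1Over {S : ℕ → LocDomainSys} (D : FmtDataOver S) (C : ChartData D.toFmtData) {W : ℕ → Type} [∀ K, TopologicalSpace (W K)] [∀ K, Zero (W K)]
    (Φf : (K : ℕ) → W K → ℂ) (ι : (K : ℕ) → W K → (Fin (C.m K) → ℂ)) : Prop :=
  ∀ K, ∀ᶠ B in 𝓝 (0 : W K), Φf K B = ∑ X : (S K).Dom, D.E K X (C.χ K X (ι K B))

/-- (S1) over the fixed index delivers PT-A's first hypothesis (a neighbourhood `U ∈ 𝓝 0` on which the functional IS the sum of the pieces `g X := E_X ∘ χ_X ∘ ι`). [cite: Balaban1987RG1, (1.6)–(1.7) p.261] -/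
theorem exists_nhds_of_reprS1Over {S : ℕ → LocDomainSys} {D : FmtDataOver S} {C : ChartData D.toFmtData} {W : ℕ → Type} [∀ K, TopologicalSpace (W K)] [∀ K, Zero (W K)]
    {Φf : (K : ℕ) → W K → ℂ} {ι : (K : ℕ) → W K → (Fin (C.m K) → ℂ)} (h : ReprS1Over D C Φf ι) (K : ℕ) :
    ∃ U ∈ 𝓝 (0 : W K), ∀ B ∈ U, Φf K B = ∑ X : (S K).Dom, (fun X B => D.E K X (C.χ K X (ι K B))) X B :=
  (h K).exists_mem

/-! ## §12  (J1) SINGLE-ITEM FORM (CRIT-1 l.3447): if the record's pieces are not DEFINABLE by name before the construction ([I] §3 + [II]: they are OUTPUTS of the R-operation —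
cf. the tree's gauge-field-level `Node00.LocalizedFamily` ∕ `Repr0224`, «asserted nowhere»), the four obligations cannot be four ledger items (each separately junk-closable: `E := 0`,
`Uc := ∅`); they are ONE ∃ over SHARED data.  (J1) one `D` carries T1's bounds, (S1)'s equation and 27932′'s chart image; (J2) `Φf` is a PARAMETER (:= the record's merged effective
action through `expChart`, by tree name, at instantiation); (J3) `E₀ κ` (and `α₂ C₉ δ₀ w`) are parameters OUTSIDE every binder; (J4) `ChartObligations C α₂` speaks of `D.Uc` because
`C : ChartData D.toFmtData`.  The split then survives as the PROOF's structure (§2–§11), not as items. -/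

/-- **THM-3 FORMAT BUNDLE for a functional family `Φf` over a FIXED index `S`** (for the record: `S := recordDomSys F Mc k`, `Φf K B := ℰ_K(exp ρ_K B)`): there EXIST shared piece data,
a chart, response data and a continuous linear coordinate embedding such that T1's obligations ((1.18) absolute + analytic + local), the chart containment at radius `α₂`, the [15]
Prop-9 response obligations and the (S1) equation ALL hold of the same data. [cite: Balaban1987RG1, Thm 3 p.264, (1.6)–(1.7) p.261, (1.18) p.263; Balaban1985Variational, Prop. 9] -/
def ThmThreeFormatBundle (S : ℕ → LocDomainSys) {W : ℕ → Type} [∀ K, NormedAddCommGroup (W K)] [∀ K, NormedSpace ℝ (W K)]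
    (Φf : (K : ℕ) → W K → ℂ) (N : ℕ → ℕ) (E₀ κ α₂ C₉ δ₀ w : ℝ) : Prop :=
  ∃ (D : FmtDataOver S) (C : ChartData D.toFmtData) (R : ResponseData D.toFmtData C) (ι : (K : ℕ) → W K →L[ℝ] (Fin (C.m K) → ℂ)),
    FmtObligationsOver D E₀ κ ∧ ChartObligations C α₂ ∧ ResponseObligations R N C₉ δ₀ w ∧ ReprS1Over D C Φf (fun K B => ι K B)

/-- The bundle hands back the three obligation Props on ONE data triple (for `n3PairShapeAt_of_obligations`) together with the (S1) equation on the same pieces. -/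
theorem ThmThreeFormatBundle.obligations {S : ℕ → LocDomainSys} {W : ℕ → Type} [∀ K, NormedAddCommGroup (W K)] [∀ K, NormedSpace ℝ (W K)]
    {Φf : (K : ℕ) → W K → ℂ} {N : ℕ → ℕ} {E₀ κ α₂ C₉ δ₀ w : ℝ} (h : ThmThreeFormatBundle S Φf N E₀ κ α₂ C₉ δ₀ w) :
    ∃ (D : FmtDataOver S) (C : ChartData D.toFmtData) (R : ResponseData D.toFmtData C) (ι : (K : ℕ) → W K →L[ℝ] (Fin (C.m K) → ℂ)),
      FmtObligations D.toFmtData E₀ κ ∧ FmtLocality D ∧ ChartObligations C α₂ ∧ ResponseObligations R N C₉ δ₀ w ∧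
      ∀ K, ∃ U ∈ 𝓝 (0 : W K), ∀ B ∈ U, Φf K B = ∑ X : (S K).Dom, D.E K X (C.χ K X (ι K B)) := by
  obtain ⟨D, C, R, ι, ⟨hD, hloc⟩, hC, hR, hS1⟩ := h
  exact ⟨D, C, R, ι, hD, hloc, hC, hR, fun K => (hS1 K).exists_mem⟩


/-! ## CRIT-1 g32 — JUNK PROBE of `ThmThreeFormatBundle` (lens-1 dictionary v3 0dd484ce1e459aed §12 :700).
CLAIM UNDER TEST (REF pass 34: «conforms to (J1)–(J4) BY CONSTRUCTION»): is the ∃ over `(D, C, R, ι)` junk-proof?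
ANSWER (kernel, below): NO — for ANY index family `S`, ANY cube-cover ∕ site-geometry data, and ANY scalar functional family `Φf K`
merely ANALYTIC AT 0 with `‖Φf K 0‖ < E₀·e^{−κ d(X₀ K)}` for some chosen domain `X₀ K`, the bundle is inhabited by the ONE-PIECE junk:
`E K X₀ := Φf K ∘ (rescale)`, all other pieces `0`, `Uc := ball 0 α₂`, chart `χ := id`, embedding `ι := (α₂∕r)•id`, `coordsOf := univ`,
response `Gk := 0`, `cX := ∅`, `wrap := univ` (voids every coupling conjunct).  Hence the ∃-bundle's content reduces to the SIZE of
`‖ℰ_K(1)‖` against `E₀` — an accident of normalisation, not Thm 3.  REPAIR (mould M, see STATUS): ∃ over the PIECES `E` (and at most `E₀`)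
ONLY; `Uc, χ, ι, coordsOf, M, m, wrap, cX, siteOf, jX, emb, πc, Gk` BY TREE∕DEF-1 NAME. -/
namespace Crit1JunkBundle
open Classical in
theorem junk_thmThreeFormatBundle (S : ℕ → LocDomainSys) (X₀ : (K : ℕ) → (S K).Dom)
    (Cc : (K : ℕ) → B12.CubeCover (S K)) (Λ : ℕ → Type) (G : (K : ℕ) → SiteGeometry (Cc K) (Λ K))
    (e : (K : ℕ) → Fin 4 → (Fin 4 → ℤ) → Λ K)
    (Φf : ℕ → ℂ → ℂ) (hΦ : ∀ K, AnalyticAt ℂ (Φf K) 0)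
    (N : ℕ → ℕ) {E₀ κ α₂ C₉ δ₀ w : ℝ} (hα : 0 < α₂) (hC₉ : 0 ≤ C₉) (hδ₀ : 0 ≤ δ₀) (hw : 0 ≤ w)
    (hE : ∀ K, ‖Φf K 0‖ < E₀ * Real.exp (-κ * (S K).dj (X₀ K))) :
    ThmThreeFormatBundle S (W := fun _ => ℂ) (fun K B => Φf K B) N E₀ κ α₂ C₉ δ₀ w := by
  have hE₀ : 0 < E₀ := by
    have h1 := lt_of_le_of_lt (norm_nonneg _) (hE 0)
    nlinarith [Real.exp_pos (-κ * (S 0).dj (X₀ 0)), h1]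
  -- a radius on which `Φf K` is analytic and below the (1.18) bound of the chosen domain
  have hnhds : ∀ K, ∀ᶠ y in 𝓝 (0 : ℂ), AnalyticAt ℂ (Φf K) y ∧ ‖Φf K y‖ < E₀ * Real.exp (-κ * (S K).dj (X₀ K)) := fun K =>
    ((hΦ K).eventually_analyticAt).and (((hΦ K).continuousAt.norm).eventually (gt_mem_nhds (hE K)))
  choose r hr hball using fun K => Metric.eventually_nhds_iff_ball.mp (hnhds K)
  -- rescaling constants `γ K = (α₂ / r K)⁻¹` as complex numbers
  have hc0 : ∀ K, 0 < α₂ / r K := fun K => div_pos hα (hr K)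
  set γ : ℕ → ℂ := fun K => (((α₂ / r K : ℝ) : ℂ))⁻¹ with hγ
  have hcC : ∀ K, ((α₂ / r K : ℝ) : ℂ) ≠ 0 := fun K => by exact_mod_cast (hc0 K).ne'
  -- the pulled-back argument lands in the good ball
  have harg : ∀ K (u : Fin 1 → ℂ), u ∈ ball (0 : Fin 1 → ℂ) α₂ → u 0 * γ K ∈ ball (0 : ℂ) (r K) := by
    intro K u hu
    rw [mem_ball_zero_iff] at hu ⊢
    have h0 : ‖u 0‖ ≤ ‖u‖ := norm_le_pi_norm u 0
    rw [hγ, norm_mul, norm_inv, Complex.norm_real, Real.norm_eq_abs, abs_of_pos (hc0 K)]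
    calc ‖u 0‖ * (α₂ / r K)⁻¹ < α₂ * (α₂ / r K)⁻¹ :=
          mul_lt_mul_of_pos_right (lt_of_le_of_lt h0 hu) (inv_pos.mpr (hc0 K))
      _ = r K := by field_simp
  -- THE JUNK DATA: one piece on `X₀ K` carrying the whole functional, every other piece zero
  refine ⟨{ M := fun _ => 1
            E := fun K X u => if X = X₀ K then Φf K (u 0 * γ K) else 0
            Uc := fun K _ => ball (0 : Fin 1 → ℂ) α₂
            coordsOf := fun _ _ => Finset.univ },
          { m := fun _ => 1, χ := fun _ _ w => w },
          { Cc := Cc, Λ := Λ, G := G, ρ := fun _ _ _ => 0, e := e, cX := fun _ _ => ∅, siteOf := fun K _ => e K 0 0,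
            Gk := fun _ _ _ => 0, wrap := fun _ => Finset.univ, emb := fun K _ => X₀ (K + 1), jX := fun _ _ i => i,
            πc := fun _ _ u => u },
          fun K => (α₂ / r K) • ContinuousLinearMap.pi fun _ : Fin 1 => ContinuousLinearMap.id ℝ ℂ,
          ⟨⟨?_, ?_⟩, ?_⟩, ⟨?_, ?_⟩, ⟨hC₉, hδ₀, hw, ?_, ?_, ?_, ?_, ?_, ?_⟩, ?_⟩
  · -- analyticity of every piece on `Uc`
    intro K X
    show AnalyticOnNhd ℂ (fun u : Fin 1 → ℂ => if X = X₀ K then Φf K (u 0 * γ K) else 0) (ball (0 : Fin 1 → ℂ) α₂)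
    by_cases hX : X = X₀ K
    · rw [show (fun u : Fin 1 → ℂ => if X = X₀ K then Φf K (u 0 * γ K) else 0) = fun u => Φf K (u 0 * γ K) from
        funext fun u => if_pos hX]
      intro u hu
      have hlin : AnalyticAt ℂ (fun v : Fin 1 → ℂ => v 0 * γ K) u :=
        ((ContinuousLinearMap.proj (R := ℂ) (φ := fun _ : Fin 1 => ℂ) 0).analyticAt u).mul analyticAt_const
      show AnalyticAt ℂ ((Φf K) ∘ (fun v : Fin 1 → ℂ => v 0 * γ K)) u
      exact AnalyticAt.comp (hball K _ (harg K u hu)).1 hlin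
    · rw [show (fun u : Fin 1 → ℂ => if X = X₀ K then Φf K (u 0 * γ K) else 0) = fun _ => 0 from
        funext fun u => if_neg hX]
      exact analyticOnNhd_const
  · -- the (1.18) bound of every piece on `Uc`
    intro K X
    show ∀ u ∈ ball (0 : Fin 1 → ℂ) α₂, ‖(if X = X₀ K then Φf K (u 0 * γ K) else 0 : ℂ)‖ ≤ E₀ * Real.exp (-κ * (S K).dj X)
    intro u hu
    by_cases hX : X = X₀ K
    · rw [if_pos hX]; subst hX
      exact (hball K _ (harg K u hu)).2.le
    · rw [if_neg hX, norm_zero]; positivity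
  · -- coordinate locality with `coordsOf := univ`
    intro K X u u' h
    have : u = u' := funext fun i => h i (Finset.mem_univ i)
    subst this; rfl
  · -- the chart `id` is entire
    intro K X
    show AnalyticOnNhd ℂ (fun w : Fin 1 → ℂ => w) Set.univ
    exact fun w _ => analyticAt_id
  · -- and maps the α₂-ball into `Uc = ball 0 α₂`
    intro K X
    show Set.MapsTo (fun w : Fin 1 → ℂ => w) (ball 0 α₂) (ball 0 α₂)
    exact fun w hw => hw
  · -- response decay: `Gk := 0`
    intro K x i
    show ‖(0 : ℂ)‖ ≤ C₉ * Real.exp (-δ₀ * (0 : ℝ))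
    rw [norm_zero]; positivity
  · intro K X i hi; exact absurd hi (Finset.notMem_empty i)
  · intro K X hX; exact absurd (Finset.mem_univ X) hX
  · intro K X hX; exact absurd (Finset.mem_univ X) hX
  · intro K X hX; exact absurd (Finset.mem_univ X) hX
  · intro K X hX; exact absurd (Finset.mem_univ X) hX
  · -- (S1): the one piece reproduces `Φf K` EXACTLY (not only near 0)
    intro K
    refine Filter.Eventually.of_forall fun B => ?_
    show Φf K B = ∑ X : (S K).Dom,
      (if X = X₀ K then Φf K ((((α₂ / r K) • ContinuousLinearMap.pi fun _ : Fin 1 => ContinuousLinearMap.id ℝ ℂ) B) 0 * γ K) else 0)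
    rw [Finset.sum_ite_eq' Finset.univ (X₀ K), if_pos (Finset.mem_univ _)]
    have hι : (((α₂ / r K) • ContinuousLinearMap.pi fun _ : Fin 1 => ContinuousLinearMap.id ℝ ℂ) B) 0
        = ((α₂ / r K : ℝ) : ℂ) * B := by
      simp [Complex.real_smul]
    rw [hι]
    simp only [hγ]
    rw [mul_comm (((α₂ / r K : ℝ) : ℂ)) B, mul_inv_cancel_right₀ (hcC K)]
end Crit1JunkBundle

end Summit.QuantumFields.YangMills.Cruxes.Record13SepCoPHInhabited.Crit1DictV3Copy

end
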